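import Summits.CriticalPhenomena.PercolationContinuityZ3.Theorems.PercNearOneGluingNoHeavyLowerTailSuperTerminalP3LamBFreePieces
import HarnessLib

/-!
# `P3_λ` (`λ ≥ 3/2`): the row only sees the pieces that touch the port AND `b` AND `{s,a}` (assembly)

Support file for crux `stmt-CriticalPhenomena-4575` (`NoHeavyLowerTail`), seat `prim-l12-p1` gen 33 (`--supports stmt-CriticalPhenomena-4575`);
sequel of `…SuperTerminalP3LamBFreePieces` (cell algebra and shape of `b`-free pieces), `…PortPiecesTwo`, `…PortPieces`.  No definitions,
no sorries, standard axioms.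

Row `P3_λ`: `μ(F)·μ(c ↔ T) ≤ λ·μ(F ∩ c ↔ T)`, `F = {s↔a} ∩ {s↮b}`, `T = {s,a,b}` (sharp conjectured constant `λ = 3/2`).  In the induction of
`SuperTerminalP3LamPortPieces.p3lam_of_portPieces` over partial unions, a piece outside `J` is now allowed to be of three kinds: port-free
(`dvec_portIsolated` + `dvec_p3lam_mul_portIsolated`), `b`-free (`dvec_bFreePiece` + `dvec_p3lam_mul_bFree`, Harris inequality of the piece), or
`{s,a}`-free (`dvec_cbPiece` + `dvec_p3lam_mul_cbShape`).  The pieces that remain are exactly those touching `c`, `b` and at least one of `s, a`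
— for ABSTRACT laws this is sharp: the two-piece counterexamples at `λ = 3/2` of `FROM-prim-l12-p1-g32-P3SHARP-DOWNSET-ANALYSIS.md` use a piece
touching `c, s, b` (missing `a`).
-/

namespace Summit.CriticalPhenomena.PercolationContinuityZ3.Theorems.SuperTerminalP3LamPortPiecesThree

open MeasureTheory Set Filter
open Literature.Probability.Percolation Literature.Probability.Percolation.PartitionGluing
open Literature.Probability.LatticeModels (prodBernoulli)
open SuperTerminalDownsets SuperTerminalDownsetEvents SuperTerminalP3LamDvec SuperTerminalP3LamPortPieces SuperTerminalP3LamPortTermPairs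
  SuperTerminalP3LamPortPiecesTwo SuperTerminalP3LamBFreePieces
open scoped Classical

variable {V : Type*} [Fintype V]

/-- The row `P3_λ` in down-set coordinates (as in `…SuperTerminalP3LamDvec`).  Local notation only. -/
local notation "RowLam[" lam ";" x0 "," x1 "," x2 "," x3 "," x4 "," x5 "," x6 "," x7 "]" =>
  (((x2 - x3 + x4 - x5 - x6 - x1 + 2 * x0) * (1 - x7) ≤ lam * (x2 - x3 + x4 - x5 - x6 - 2 * x1 + 3 * x0)) : Prop)

/-! ## The assembly -/

section Pieces
variable {s a b c : V}

/-- **MAIN THEOREM: for `λ ≥ 3/2`, every `{s,a,b,c}`-piece that misses the port, or misses `b`, or misses `{s,a}` is irrelevant to `P3_λ`.**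
Let `s a b c` be pairwise distinct, `part : V → ι` a splitting of `w` along `{s,a,b,c}`, and `J` a set of labels such that every piece
`i ∉ J` misses `c`, or misses `b`, or misses both `s` and `a` (on the vertices `v` of the piece: `w(c,v) = 0`, resp. `w(b,v) = 0`, resp.
`w(s,v) = w(a,v) = 0`).  If the partial union `w_J := w·1_{terminal pairs ∪ pieces of J}` satisfies the row, so does `w`.  Hence a
counterexample to the sharp row `P3_{3/2}` with the fewest active vertices is a union of pieces EACH touching the port AND `b` AND `{s,a}`. [this work] -/
theorem p3lam_of_portPieces₃ {ι : Type*} [Fintype ι] {lam : ℝ} (hlam : 3 / 2 ≤ lam) (w : Sym2 V → unitInterval)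
    (hd : s ≠ a ∧ s ≠ b ∧ s ≠ c ∧ a ≠ b ∧ a ≠ c ∧ b ≠ c) (part : V → ι)
    (hw : ∀ x y : V, x ∉ ({s, a, b, c} : Finset V) → y ∉ ({s, a, b, c} : Finset V) → part x ≠ part y → (w s(x, y) : ℝ) = 0)
    (J : Finset ι) (hJ : ∀ i, i ∉ J →
      (∀ v : V, v ∉ ({s, a, b, c} : Finset V) → part v = i → (w s(c, v) : ℝ) = 0) ∨
      (∀ v : V, v ∉ ({s, a, b, c} : Finset V) → part v = i → (w s(b, v) : ℝ) = 0) ∨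
      (∀ v : V, v ∉ ({s, a, b, c} : Finset V) → part v = i → (w s(s, v) : ℝ) = 0 ∧ (w s(a, v) : ℝ) = 0))
    (hrow :
      (prodBernoulli fun e => if e ∈ ({s, a, b, c} : Finset V).sym2 ∨ ∃ i ∈ J, e ∈ piecePairs {s, a, b, c} part i then w e else 0).real
          (openConn s a ∩ (openConn s b)ᶜ : Set (BondConfig V)) *
        (prodBernoulli fun e => if e ∈ ({s, a, b, c} : Finset V).sym2 ∨ ∃ i ∈ J, e ∈ piecePairs {s, a, b, c} part i then w e else 0).real
          ((openConn c s)ᶜ ∩ (openConn c a)ᶜ ∩ (openConn c b)ᶜ : Set (BondConfig V))ᶜ ≤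
      lam * (prodBernoulli fun e => if e ∈ ({s, a, b, c} : Finset V).sym2 ∨ ∃ i ∈ J, e ∈ piecePairs {s, a, b, c} part i
          then w e else 0).real
          (openConn s a ∩ (openConn s b)ᶜ ∩ ((openConn c s)ᶜ ∩ (openConn c a)ᶜ ∩ (openConn c b)ᶜ)ᶜ : Set (BondConfig V))) :
    (prodBernoulli w).real (openConn s a ∩ (openConn s b)ᶜ : Set (BondConfig V)) *
        (prodBernoulli w).real ((openConn c s)ᶜ ∩ (openConn c a)ᶜ ∩ (openConn c b)ᶜ : Set (BondConfig V))ᶜ ≤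
      lam * (prodBernoulli w).real (openConn s a ∩ (openConn s b)ᶜ ∩ ((openConn c s)ᶜ ∩ (openConn c a)ᶜ ∩ (openConn c b)ᶜ)ᶜ : Set (BondConfig V)) := by
  -- abbreviations: the terminal piece and the pieces
  set w₀ : Sym2 V → unitInterval := fun e => if e ∈ ({s, a, b, c} : Finset V).sym2 then w e else 0 with hw₀
  set wp : ι → Sym2 V → unitInterval := fun i e => if e ∈ piecePairs {s, a, b, c} part i then w e else 0 with hwp
  -- transfer of 'the pairs of the piece at terminal `t` vanish' to the piece weight
  have htr : ∀ (i : ι) (t : V), t ∈ ({s, a, b, c} : Finset V) →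
      (∀ v : V, v ∉ ({s, a, b, c} : Finset V) → part v = i → (w s(t, v) : ℝ) = 0) →
      ∀ x : V, x ≠ t → ((wp i) s(t, x) : ℝ) = 0 := by
    intro i t ht hzero x hx
    by_cases hmem : s(t, x) ∈ piecePairs ({s, a, b, c} : Finset V) part i
    · obtain ⟨u, v, ⟨hu, hui⟩, -, -, he⟩ := mem_piecePairs.1 hmem
      rcases Sym2.eq_iff.1 he with ⟨h1, -⟩ | ⟨-, h2⟩
      · exact absurd (h1 ▸ ht) hu
      · have hxT : x ∉ ({s, a, b, c} : Finset V) := h2 ▸ hu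
        have hpx : part x = i := by rw [h2, hui]
        have h0 := hzero x hxT hpx
        simp only [hwp, if_pos hmem]
        exact h0
    · simp only [hwp, if_neg hmem]
      rfl
  have hsT : s ∈ ({s, a, b, c} : Finset V) := by simp
  have haT : a ∈ ({s, a, b, c} : Finset V) := by simp
  have hbT : b ∈ ({s, a, b, c} : Finset V) := by simp
  have hcT : c ∈ ({s, a, b, c} : Finset V) := by simp
  have Cp := fun i => core_of_weight (wp i) s a b c
  -- induction over sets `S` of pieces outside `J`: the vector `D(w₀)·∏_{i ∈ J ∪ S} D(wᵢ)` (= `D(w_{J ∪ S})`) satisfies the row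
  have key : ∀ S : Finset ι, (∀ i ∈ S, i ∉ J) →
      RowLam[lam;
        (prodBernoulli w₀).real ((openConn s a)ᶜ ∩ (openConn s b)ᶜ ∩ (openConn s c)ᶜ ∩ (openConn a b)ᶜ ∩ (openConn a c)ᶜ ∩ (openConn b c)ᶜ) *
          ∏ i ∈ J ∪ S, (prodBernoulli (wp i)).real
            ((openConn s a)ᶜ ∩ (openConn s b)ᶜ ∩ (openConn s c)ᶜ ∩ (openConn a b)ᶜ ∩ (openConn a c)ᶜ ∩ (openConn b c)ᶜ),
        (prodBernoulli w₀).real ((openConn s b)ᶜ ∩ (openConn s c)ᶜ ∩ (openConn a b)ᶜ ∩ (openConn a c)ᶜ ∩ (openConn b c)ᶜ) *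
          ∏ i ∈ J ∪ S, (prodBernoulli (wp i)).real ((openConn s b)ᶜ ∩ (openConn s c)ᶜ ∩ (openConn a b)ᶜ ∩ (openConn a c)ᶜ ∩ (openConn b c)ᶜ),
        (prodBernoulli w₀).real ((openConn s b)ᶜ ∩ (openConn s c)ᶜ ∩ (openConn a b)ᶜ ∩ (openConn a c)ᶜ) *
          ∏ i ∈ J ∪ S, (prodBernoulli (wp i)).real ((openConn s b)ᶜ ∩ (openConn s c)ᶜ ∩ (openConn a b)ᶜ ∩ (openConn a c)ᶜ),
        (prodBernoulli w₀).real ((openConn s a)ᶜ ∩ (openConn s b)ᶜ ∩ (openConn s c)ᶜ ∩ (openConn a b)ᶜ ∩ (openConn a c)ᶜ) *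
          ∏ i ∈ J ∪ S, (prodBernoulli (wp i)).real ((openConn s a)ᶜ ∩ (openConn s b)ᶜ ∩ (openConn s c)ᶜ ∩ (openConn a b)ᶜ ∩ (openConn a c)ᶜ),
        (prodBernoulli w₀).real ((openConn s b)ᶜ ∩ (openConn a b)ᶜ ∩ (openConn b c)ᶜ) *
          ∏ i ∈ J ∪ S, (prodBernoulli (wp i)).real ((openConn s b)ᶜ ∩ (openConn a b)ᶜ ∩ (openConn b c)ᶜ),
        (prodBernoulli w₀).real ((openConn s a)ᶜ ∩ (openConn s b)ᶜ ∩ (openConn a b)ᶜ ∩ (openConn a c)ᶜ ∩ (openConn b c)ᶜ) *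
          ∏ i ∈ J ∪ S, (prodBernoulli (wp i)).real ((openConn s a)ᶜ ∩ (openConn s b)ᶜ ∩ (openConn a b)ᶜ ∩ (openConn a c)ᶜ ∩ (openConn b c)ᶜ),
        (prodBernoulli w₀).real ((openConn s a)ᶜ ∩ (openConn s b)ᶜ ∩ (openConn s c)ᶜ ∩ (openConn a b)ᶜ ∩ (openConn b c)ᶜ) *
          ∏ i ∈ J ∪ S, (prodBernoulli (wp i)).real ((openConn s a)ᶜ ∩ (openConn s b)ᶜ ∩ (openConn s c)ᶜ ∩ (openConn a b)ᶜ ∩ (openConn b c)ᶜ),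
        (prodBernoulli w₀).real ((openConn c s)ᶜ ∩ (openConn c a)ᶜ ∩ (openConn c b)ᶜ) *
          ∏ i ∈ J ∪ S, (prodBernoulli (wp i)).real ((openConn c s)ᶜ ∩ (openConn c a)ᶜ ∩ (openConn c b)ᶜ)] := by
    intro S
    induction S using Finset.induction_on with
    | empty =>
      intro _
      -- the hypothesis on `w_J`, in down-set coordinates, split along `J`
      have GJ := (rowLam_iff (fun e => if e ∈ ({s, a, b, c} : Finset V).sym2 ∨ ∃ i ∈ J, e ∈ piecePairs {s, a, b, c} part i
        then w e else 0) lam s a b c).1 hrow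
      have pu := fun blk : V → ℕ => real_partLE_partialUnion w ({s, a, b, c} : Finset V) part hw J blk
      rw [← partLE_blk0 hd, ← partLE_blk1 hd, ← partLE_blk2 hd, ← partLE_blk3 hd, ← partLE_blk4 hd, ← partLE_blk5 hd,
        ← partLE_blk6 hd, ← partLE_blk7 hd] at GJ
      simp only [pu] at GJ
      rw [partLE_blk0 hd, partLE_blk1 hd, partLE_blk2 hd, partLE_blk3 hd, partLE_blk4 hd, partLE_blk5 hd, partLE_blk6 hd,
        partLE_blk7 hd] at GJ
      simpa only [Finset.union_empty] using GJ
    | @insert j S hj ih =>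
      intro hS
      have hjJ : j ∉ J := hS j (Finset.mem_insert_self j S)
      have IH := ih fun i hi => hS i (Finset.mem_insert_of_mem hi)
      -- the partial union `w_{J ∪ S}` is a weighted graph: order relations and face inequality for `D(w₀)·∏_{i∈J∪S} D(wᵢ)`
      have pu := fun blk : V → ℕ => real_partLE_partialUnion w ({s, a, b, c} : Finset V) part hw (J ∪ S) blk
      have CS := core_of_weight (fun e => if e ∈ ({s, a, b, c} : Finset V).sym2 ∨ ∃ i ∈ J ∪ S, e ∈ piecePairs {s, a, b, c} part i
        then w e else 0) s a b c
      have FS := face_of_weight (fun e => if e ∈ ({s, a, b, c} : Finset V).sym2 ∨ ∃ i ∈ J ∪ S, e ∈ piecePairs {s, a, b, c} part i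
        then w e else 0) hd
      rw [← partLE_blk0 hd, ← partLE_blk1 hd, ← partLE_blk2 hd, ← partLE_blk3 hd, ← partLE_blk4 hd, ← partLE_blk5 hd,
        ← partLE_blk6 hd, ← partLE_blk7 hd] at CS
      rw [← partLE_blk1 hd, ← partLE_blk2 hd, ← partLE_blk4 hd, ← partLE_blk7 hd] at FS
      simp only [pu] at CS FS
      rw [partLE_blk0 hd, partLE_blk1 hd, partLE_blk2 hd, partLE_blk3 hd, partLE_blk4 hd, partLE_blk5 hd, partLE_blk6 hd,
        partLE_blk7 hd] at CS
      rw [partLE_blk1 hd, partLE_blk2 hd, partLE_blk4 hd, partLE_blk7 hd] at FS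
      have hu : J ∪ insert j S = insert j (J ∪ S) := Finset.union_insert j J S
      have hj' : j ∉ J ∪ S := by
        rw [Finset.mem_union, not_or]; exact ⟨hjJ, hj⟩
      have r : ∀ (x : ℝ) (y : ι → ℝ), x * ∏ i ∈ J ∪ insert j S, y i = x * (∏ i ∈ J ∪ S, y i) * y j := fun x y => by
        rw [hu, Finset.prod_insert hj']; ring
      simp only [r]
      -- the new piece: port-free, or of `cb` / `cs` / `ca` shape
      have hlam' : 4 / 3 ≤ lam := by linarith
      obtain ⟨g0, g1, g3, g5, g6, g7, g71, gζ, gτ⟩ := Cp j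
      rcases hJ j hjJ with h0 | h1 | h2
      · obtain ⟨q2, q3, q4, q5, q6, q7⟩ := dvec_portIsolated (wp j) hd (htr j c hcT h0)
        exact dvec_p3lam_mul_portIsolated hlam CS IH FS q2 q3 q4 q5 q6 q7 g0 g1
      · obtain ⟨q2, q3, q4, q7, hle, hall, hH⟩ := dvec_bFreePiece (wp j) hd (htr j b hbT h1)
        exact dvec_p3lam_mul_bFree hlam CS IH FS q2 q3 q4 q7 g0 g1 g5 g6 hle hall hH
      · obtain ⟨q0, q1, q2, q3, q4, q5, q6⟩ := dvec_cbPiece (wp j) hd (htr j s hsT fun v hv hpv => (h2 v hv hpv).1)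
          (htr j a haT fun v hv hpv => (h2 v hv hpv).2)
        exact dvec_p3lam_mul_cbShape hlam' CS IH q0 q1 q2 q3 q4 q5 q6 g7 g71
  -- at `S = univ ∖ J` the vector is `D(w)` by the splitting formula
  set S : Finset ι := Finset.univ.filter fun i => i ∉ J with hSdef
  have hS : ∀ i ∈ S, i ∉ J := fun i hi => (Finset.mem_filter.1 hi).2
  have hJS : J ∪ S = Finset.univ := by
    ext i
    simp only [Finset.mem_union, Finset.mem_univ, iff_true, hSdef, Finset.mem_filter, true_and]
    exact em _
  have K := key S hS
  rw [hJS] at K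
  have S0 := real_partLE_eq_terminalPiece_mul_prod w ({s, a, b, c} : Finset V) part
    (fun v => if v = a then 1 else if v = b then 2 else if v = c then 3 else (0 : ℕ)) hw
  have S1 := real_partLE_eq_terminalPiece_mul_prod w ({s, a, b, c} : Finset V) part
    (fun v => if v = b then 1 else if v = c then 2 else (0 : ℕ)) hw
  have S2 := real_partLE_eq_terminalPiece_mul_prod w ({s, a, b, c} : Finset V) part
    (fun v => if v = b ∨ v = c then 1 else (0 : ℕ)) hw
  have S3 := real_partLE_eq_terminalPiece_mul_prod w ({s, a, b, c} : Finset V) part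
    (fun v => if v = a then 1 else if v = b ∨ v = c then 2 else (0 : ℕ)) hw
  have S4 := real_partLE_eq_terminalPiece_mul_prod w ({s, a, b, c} : Finset V) part
    (fun v => if v = b then 1 else (0 : ℕ)) hw
  have S5 := real_partLE_eq_terminalPiece_mul_prod w ({s, a, b, c} : Finset V) part
    (fun v => if v = a then 1 else if v = b then 2 else (0 : ℕ)) hw
  have S6 := real_partLE_eq_terminalPiece_mul_prod w ({s, a, b, c} : Finset V) part
    (fun v => if v = a ∨ v = c then 1 else if v = b then 2 else (0 : ℕ)) hw
  have S7 := real_partLE_eq_terminalPiece_mul_prod w ({s, a, b, c} : Finset V) part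
    (fun v => if v = c then 1 else (0 : ℕ)) hw
  rw [partLE_blk0 hd] at S0
  rw [partLE_blk1 hd] at S1
  rw [partLE_blk2 hd] at S2
  rw [partLE_blk3 hd] at S3
  rw [partLE_blk4 hd] at S4
  rw [partLE_blk5 hd] at S5
  rw [partLE_blk6 hd] at S6
  rw [partLE_blk7 hd] at S7
  rw [← S0, ← S1, ← S2, ← S3, ← S4, ← S5, ← S6, ← S7] at K
  exact (rowLam_iff w lam s a b c).2 K

end Pieces

end Summit.CriticalPhenomena.PercolationContinuityZ3.Theorems.SuperTerminalP3LamPortPiecesThree
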